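import Summits.ResolutionOfSingularities.ResolutionOfSingularities.Theses.RisoStrata
import Literature.AlgebraicGeometry.Resolution.CentresAndCoordinates
import Literature.AlgebraicGeometry.Resolution.ResolutionProjectiveReduction
import Literature.AlgebraicGeometry.Resolution.LocalBlowup
import Literature.AlgebraicGeometry.Motives.SegreEmbeddingPoints
import Literature.AlgebraicGeometry.Resolution.CanonicalResolutionProofs
import Literature.AlgebraicGeometry.Resolution.ProjectiveModelsCharts

/-!
# Route RisoStrata — crux `RisoGlobalisation` (stmt-ResolutionOfSingularities-18547), line SketchIdeator1

SKELETON (lead prover).  Composition `RisoGlobalisation_of` closes the crux by name modulo the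
registered stubs `stub_*`.

Line (card segre-representation + exit of card graph-closure-vector):
* the crux is predicate-generic: `RisoGlobalisation` follows from `stub_core`, the same statement
  for an ARBITRARY cut predicate `P` that is Zariski-local (`RisoLocal`, H₁-shape) and for which
  every presentation has a resolving schedule (`RisoSchedule`, H₂-shape) — proved below
  (`RisoGlobalisation_of`, 0 sorries: the Hahn-series block never enters a goal again);
* `stub_core` (lead-held; to be RESHAPED into the glue over the leaves in cycle 1): Chow + projective
  closure (tree `ChowLemmaIntegral_holds`, `exists_projectiveClosure`), the base projective model
  of the function field by `ProjModel.ofChart` (as in the proved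
  `hasResolution_of_twoModelPatching_of_dim_three`), an induction on the schedule INSIDE `K`
  re-presenting each stage as the charts `k[h'_α/h'_γ]` of the Segre-type vector `h' = h ⋆ G`
  (leaves `stub_sheafCondition` → `stub_uniformGeneration` → `stub_stepEqChart`), the resolving
  model `ProjModel.ofClosure` of `(gen_X, [u])` in `X ×ₖ ℙᵐ` (leaf `stub_graphModel`), its local
  rings read in `K` (leaves `stub_chartRing`, `stub_chartMem`), regularity from H₂ and the exit
  `ProjModel.isRegular_of_forall_regCentre` + `ProjModel.Hom.hasResolution`.
-/

-- single-problem summit: the doubled namespace component `ResolutionOfSingularities` is forced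
set_option linter.dupNamespace false

namespace Summit.ResolutionOfSingularities.ResolutionOfSingularities.Theorems

open AlgebraicGeometry CategoryTheory
open Literature.AlgebraicGeometry.Resolution Literature.AlgebraicGeometry.Motives

attribute [local instance] MvPolynomial.gradedAlgebra

/-! ## The route's tower vocabulary, generic in the cut predicate (→ `RisoStrataDefs.lean`, p145136) -/

section Defs
variable {k K : Type} [Field k] [Field K] [Algebra k K]

/-- The centre ideal `Cen B d` (route RisoStrata, `let Cen`), generic in the cut predicate `P`. -/
def risoCen (P : ∀ B : Subalgebra k K, Ideal ↥B → ℕ → Prop) (B : Subalgebra k K) (d : ℕ) :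
    Ideal ↥B :=
  ⨅ m ∈ {m : Ideal ↥B | ∃ hm : m.IsMaximal,
    ¬ IsRegularLocalRing (Localization (@Ideal.primeCompl ↥B _ m hm.isPrime)) ∧ P B m d}, m

/-- The blow-up chart `step B d x` (route RisoStrata, `let step`). -/
def risoStep (P : ∀ B : Subalgebra k K, Ideal ↥B → ℕ → Prop) (B : Subalgebra k K) (d : ℕ)
    (xt : K) : Subalgebra k K :=
  Algebra.adjoin k ((B : Set K) ∪ {y | ∃ a ∈ risoCen P B d, y = (a : K) * xt⁻¹})

/-- Admissible denominator (route RisoStrata, `let Valid`). -/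
def risoValid (P : ∀ B : Subalgebra k K, Ideal ↥B → ℕ → Prop) (O : ValuationSubring K)
    (B : Subalgebra k K) (d : ℕ) (xt : K) : Prop :=
  xt ≠ 0 ∧ (∃ x ∈ risoCen P B d, (x : K) = xt) ∧ ∀ a' ∈ risoCen P B d, (a' : K) * xt⁻¹ ∈ O

/-- The `t`-th stage of the tower (route RisoStrata, `let stage`). -/
def risoStage (P : ∀ B : Subalgebra k K, Ideal ↥B → ℕ → Prop) (B₀ : Subalgebra k K)
    (sched : List ℕ) (x : ℕ → K) (t : ℕ) : Subalgebra k K :=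
  ((sched.take t).zipIdx).foldl (fun B de => risoStep P B de.1 (x de.2)) B₀

/-- The local ring at the centre of `O` inside `K` (route RisoStrata, `let loc`). -/
def risoLoc (O : ValuationSubring K) (B : Subalgebra k K) : Subalgebra k K :=
  Algebra.adjoin k {y | ∃ a ∈ B, ∃ s ∈ B, s⁻¹ ∈ O ∧ y = a * s⁻¹}

/-- Zariski-locality of the cut predicate (shape of crux `RtdLocal`). -/
def RisoLocal (P : ∀ B : Subalgebra k K, Ideal ↥B → ℕ → Prop) : Prop :=
  ∀ (B : Subalgebra k K) (s : K) (_ : s ∈ B), s ≠ 0 → B.FG →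
    ∀ m' : Ideal ↥(Algebra.adjoin k ((B : Set K) ∪ {s⁻¹})), m'.IsMaximal → ∀ d : ℕ,
      (P (Algebra.adjoin k ((B : Set K) ∪ {s⁻¹})) m' d ↔
        P B (m'.comap (Subalgebra.inclusion
          (show B ≤ Algebra.adjoin k ((B : Set K) ∪ {s⁻¹}) from
            fun _ hb => Algebra.subset_adjoin (Set.mem_union_left _ hb)))) d)

/-- One schedule resolves the presentation `h` along every valuation (shape of the conclusion of
crux `RisoCentresResolve`). -/
def RisoSchedule (P : ∀ B : Subalgebra k K, Ideal ↥B → ℕ → Prop) (N : ℕ)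
    (h : Fin (N + 1) → K) : Prop :=
  ∃ sched : List ℕ, ∀ O : ValuationSubring K, (∀ c : k, algebraMap k K c ∈ O) →
    ∀ j : Fin (N + 1), (∀ i, h i * (h j)⁻¹ ∈ O) → ∀ x : ℕ → K,
      (∀ t, t < sched.length →
        risoValid P O (risoStage P (Algebra.adjoin k (Set.range fun i => h i * (h j)⁻¹)) sched x t)
          (sched.getD t 0) (x t)) →
      IsRegularLocalRing
        ↥(risoLoc O (risoStage P (Algebra.adjoin k (Set.range fun i => h i * (h j)⁻¹)) sched x
          sched.length))
/-- `stage B₀ sched x 0 = B₀`. -/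
@[simp] theorem risoStage_zero (P : ∀ B : Subalgebra k K, Ideal ↥B → ℕ → Prop)
    (B₀ : Subalgebra k K) (sched : List ℕ) (x : ℕ → K) : risoStage P B₀ sched x 0 = B₀ := rfl

end Defs

/-! ## Leaf stubs — commutative algebra inside `K` -/

section Algebra

variable {k K : Type} [Field k] [Field K] [Algebra k K]

/-- **Sheaf condition for the centre ideals of two charts** (where H₁ is consumed).  `B, B' ⊆ K`
finitely generated `k`-subalgebras with a common principal localisation
`B[s⁻¹] = B'[(s⁻¹)⁻¹]` (`s ∈ B`, `s⁻¹ ∈ B'`); the "bad" maximal ideals are the singular ones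
satisfying the Zariski-local predicate `P`; then every element of the intersection of the bad
maximal ideals of `B` becomes, after multiplication by a power of `s⁻¹`, an element of the
intersection of the bad maximal ideals of `B'` (Jacobson property of finitely generated algebras,
radical ideals are intersections of maximal ideals, the maximal ideals of `B[s⁻¹]` are those of
`B` avoiding `s`, closures commute with restriction to the open `D(s)`). -/
theorem stub_sheafCondition
    (P : ∀ B : Subalgebra k K, Ideal ↥B → Prop)
    (hP : ∀ (B : Subalgebra k K) (s : K) (_ : s ∈ B), s ≠ 0 → B.FG →
      ∀ m' : Ideal ↥(Algebra.adjoin k ((B : Set K) ∪ {s⁻¹})), m'.IsMaximal →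
        (P (Algebra.adjoin k ((B : Set K) ∪ {s⁻¹})) m' ↔
          P B (m'.comap (Subalgebra.inclusion
            (show B ≤ Algebra.adjoin k ((B : Set K) ∪ {s⁻¹}) from
              fun _ hb => Algebra.subset_adjoin (Set.mem_union_left _ hb))))))
    (B B' : Subalgebra k K) (hB : B.FG) (hB' : B'.FG) (s : K) (hsB : s ∈ B) (hsB' : s⁻¹ ∈ B')
    (hs : s ≠ 0)
    (hBB' : Algebra.adjoin k ((B : Set K) ∪ {s⁻¹}) = Algebra.adjoin k ((B' : Set K) ∪ {s⁻¹⁻¹}))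
    (c : ↥B)
    (hc : c ∈ ⨅ m ∈ {m : Ideal ↥B | ∃ hm : m.IsMaximal,
      ¬ IsRegularLocalRing (Localization (@Ideal.primeCompl ↥B _ m hm.isPrime)) ∧ P B m}, m) :
    ∃ (n : ℕ) (a : ↥B'),
      a ∈ (⨅ m ∈ {m : Ideal ↥B' | ∃ hm : m.IsMaximal,
        ¬ IsRegularLocalRing (Localization (@Ideal.primeCompl ↥B' _ m hm.isPrime)) ∧ P B' m}, m) ∧
      (a : K) = (c : K) * s⁻¹ ^ n := by
  sorry

/-- **Uniform-degree global generation** ("`𝒥(E)` is generated by global sections"): ideals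
`I_β` of the standard charts `k[hᵢ/h_β]` of the projective model of a vector `h ∈ (K×)ᴺ⁺¹`
which satisfy the pairwise sheaf condition and are nonzero are generated, on EVERY chart, by the
dehomogenisations `G_l / h_β^E` of one finite family of "forms" `G_l ∈ K×` of a common degree
`E` (take for `G` the products `c·h_β^E`, `c` running over nonzero generators of the `I_β`,
`E` large). -/
theorem stub_uniformGeneration {N : ℕ} (h : Fin (N + 1) → K) (hh : ∀ i, h i ≠ 0)
    (I : ∀ β : Fin (N + 1), Ideal ↥(Algebra.adjoin k (Set.range fun i => h i * (h β)⁻¹)))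
    (hI : ∀ β, I β ≠ ⊥)
    (hSC : ∀ (β β' : Fin (N + 1)) (c : ↥(Algebra.adjoin k (Set.range fun i => h i * (h β)⁻¹))),
      c ∈ I β → ∃ (n : ℕ) (a : ↥(Algebra.adjoin k (Set.range fun i => h i * (h β')⁻¹))),
        a ∈ I β' ∧ (a : K) = (c : K) * (h β * (h β')⁻¹) ^ n) :
    ∃ (E M : ℕ) (G : Fin (M + 1) → K) (hG : ∀ β l,
        G l * (h β ^ E)⁻¹ ∈ Algebra.adjoin k (Set.range fun i => h i * (h β)⁻¹)),
      (∀ l, G l ≠ 0) ∧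
      ∀ β, Ideal.span (Set.range fun l =>
        (⟨G l * (h β ^ E)⁻¹, hG β l⟩ : ↥(Algebra.adjoin k (Set.range fun i => h i * (h β)⁻¹)))) =
          I β := by
  sorry

/-- **The re-presentation identity `step = chart`** (Zariski–Samuel VI §17: the transform of the
projective model of `h` along forms `G` of one degree is the projective model of the products
`hᵢ G_l`): if the `G_l/h_j^E` lie in the chart `B = k[hᵢ/hⱼ]`, then adjoining to `B` all
quotients `a / (G_μ/h_j^E)`, `a` in the ideal they span, gives exactly the standard chart
`k[hᵢG_l/(hⱼG_μ)]` of the vector `(hᵢ G_l)`. -/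
theorem stub_stepEqChart {N M : ℕ} (h : Fin (N + 1) → K) (hh : ∀ i, h i ≠ 0) (j : Fin (N + 1))
    (G : Fin (M + 1) → K) (E : ℕ) (μ : Fin (M + 1)) (hμ : G μ ≠ 0)
    (hG : ∀ l, G l * (h j ^ E)⁻¹ ∈ Algebra.adjoin k (Set.range fun i => h i * (h j)⁻¹)) :
    Algebra.adjoin k ((Algebra.adjoin k (Set.range fun i => h i * (h j)⁻¹) : Set K) ∪
        {y | ∃ a ∈ Ideal.span (Set.range fun l =>
          (⟨G l * (h j ^ E)⁻¹, hG l⟩ : ↥(Algebra.adjoin k (Set.range fun i => h i * (h j)⁻¹)))),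
          y = (a : K) * (G μ * (h j ^ E)⁻¹)⁻¹}) =
      Algebra.adjoin k (Set.range fun il : Fin (N + 1) × Fin (M + 1) =>
        (h il.1 * G il.2) * (h j * G μ)⁻¹) := by
  sorry

end Algebra


/-! ## Glue (algebra): the tower inside `K` -/

section Tower

variable {k K : Type} [Field k] [Field K] [Algebra k K]

/-- Elements of `Algebra.adjoin k S` lie in every subring of `K` containing `k` and `S`
(used for valuation rings `O ⊇ k`). -/
theorem adjoin_le_of_subset {S : Set K} {O : ValuationSubring K}
    (hkO : ∀ c : k, algebraMap k K c ∈ O) (hS : S ⊆ O) {z : K} (hz : z ∈ Algebra.adjoin k S) :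
    z ∈ O := by
  induction hz using Algebra.adjoin_induction with
  | mem x hx => exact hS hx
  | algebraMap c => exact hkO c
  | add x y _ _ hx hy => exact add_mem hx hy
  | mul x y _ _ hx hy => exact mul_mem hx hy

/-- The schedule shift: the `(t+1)`-st stage along `d :: rest` is the `t`-th stage along `rest`
started from the first chart `step B₀ d (x 0)` with the shifted denominators. -/
theorem risoStage_cons_succ (P : ∀ B : Subalgebra k K, Ideal ↥B → ℕ → Prop)
    (B₀ : Subalgebra k K) (d : ℕ) (rest : List ℕ) (x : ℕ → K) (t : ℕ) :
    risoStage P B₀ (d :: rest) x (t + 1) =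
      risoStage P (risoStep P B₀ d (x 0)) rest (fun i => x (i + 1)) t := by
  unfold risoStage
  rw [List.take_succ_cons, List.zipIdx_cons, List.foldl_cons, List.zipIdx_succ, List.foldl_map]

/-- A field is a regular local ring; hence so is the localisation of a domain at `(0)`. -/
theorem isRegularLocalRing_localization_bot (A : Type) [CommRing A] [IsDomain A] :
    IsRegularLocalRing (Localization.AtPrime (⊥ : Ideal A)) := by
  have hM : (⊥ : Ideal A).primeCompl = nonZeroDivisors A := by
    ext x
    simp [Ideal.primeCompl, mem_nonZeroDivisors_iff_ne_zero]
  haveI : IsFractionRing A (Localization.AtPrime (⊥ : Ideal A)) := by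
    change IsLocalization (nonZeroDivisors A) _
    rw [← hM]
    infer_instance
  letI : Field (Localization.AtPrime (⊥ : Ideal A)) := IsFractionRing.toField A
  infer_instance

/-- **The centre ideal is nonzero**: for a finitely generated `k`-subalgebra `B ⊆ K` the
singular locus of `Spec B` is a proper closed subset `V(J)`, `J ≠ 0` (openness of the regular
locus of a finitely generated algebra over a field, tree `isOpen_regularLocus_of_finiteType_field`,
and regularity at the generic point), and `J ⊆ m` for every singular maximal ideal `m`, so
`J ≤ Cen B d`. -/
theorem risoCen_ne_bot (P : ∀ B : Subalgebra k K, Ideal ↥B → ℕ → Prop) (B : Subalgebra k K)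
    (hB : B.FG) (d : ℕ) : risoCen P B d ≠ ⊥ := by
  haveI : Algebra.FiniteType k ↥B := B.fg_iff_finiteType.mp hB
  have hopen : IsOpen (regularLocus ↥B) := isOpen_regularLocus_of_finiteType_field k ↥B
  -- the singular locus is closed, `= V(J)`
  set Sing : Set (PrimeSpectrum ↥B) := (regularLocus ↥B)ᶜ with hSing
  have hclosed : IsClosed Sing := hopen.isClosed_compl
  set J : Ideal ↥B := PrimeSpectrum.vanishingIdeal Sing with hJ
  have hVJ : PrimeSpectrum.zeroLocus (J : Set ↥B) = Sing := by
    rw [hJ, PrimeSpectrum.zeroLocus_vanishingIdeal_eq_closure, hclosed.closure_eq]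
  -- the generic point is regular, so `J ≠ ⊥`
  have hgen : (⟨⊥, Ideal.isPrime_bot⟩ : PrimeSpectrum ↥B) ∈ regularLocus ↥B :=
    isRegularLocalRing_localization_bot ↥B
  have hJ0 : J ≠ ⊥ := by
    intro h0
    have hmem : (⟨⊥, Ideal.isPrime_bot⟩ : PrimeSpectrum ↥B) ∈ PrimeSpectrum.zeroLocus (J : Set ↥B) := by
      rw [h0]; intro x hx; simpa using hx
    rw [hVJ] at hmem
    exact hmem hgen
  -- `J ≤ Cen`
  intro hbot
  apply hJ0
  refine le_bot_iff.mp (le_trans ?_ hbot.le)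
  refine le_iInf₂ fun m hm => ?_
  obtain ⟨hmax, hnreg, -⟩ := hm
  have hp : (⟨m, hmax.isPrime⟩ : PrimeSpectrum ↥B) ∈ Sing := fun hreg => hnreg hreg
  rw [← hVJ] at hp
  exact fun x hx => hp hx

/-- Notation-free name for the standard chart ring `k[hᵢ/h_β] ⊆ K` of a vector `h`. -/
theorem mem_chart_of_eq {N : ℕ} (h : Fin (N + 1) → K) (β : Fin (N + 1)) {z : K} (i : Fin (N + 1))
    (hz : z = h i * (h β)⁻¹) : z ∈ Algebra.adjoin k (Set.range fun i => h i * (h β)⁻¹) :=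
  hz ▸ Algebra.subset_adjoin ⟨i, rfl⟩

/-- The common localisation of two standard charts: `k[hᵢ/h_β][(h_β'/h_β)⁻¹] = k[hᵢ/h_β'][(h_β/h_β')⁻¹]`,
both equal to `k[hᵢ/h_β, hᵢ/h_β']`. -/
theorem adjoin_chart_inv_eq {N : ℕ} (h : Fin (N + 1) → K) (hh : ∀ i, h i ≠ 0)
    (β β' : Fin (N + 1)) :
    Algebra.adjoin k ((Algebra.adjoin k (Set.range fun i => h i * (h β)⁻¹) : Set K) ∪
        {(h β' * (h β)⁻¹)⁻¹}) =
      Algebra.adjoin k (Set.range (fun i => h i * (h β)⁻¹) ∪ Set.range fun i => h i * (h β')⁻¹) := by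
  apply le_antisymm
  · refine Algebra.adjoin_le (Set.union_subset ?_ ?_)
    · exact Algebra.adjoin_le (Set.subset_union_left.trans Algebra.subset_adjoin)
    · rintro _ rfl
      rw [mul_inv, inv_inv, mul_comm]
      exact Algebra.subset_adjoin (Or.inr ⟨β, rfl⟩)
  · refine Algebra.adjoin_le (Set.union_subset ?_ ?_)
    · rintro _ ⟨i, rfl⟩
      exact Algebra.subset_adjoin (Or.inl (Algebra.subset_adjoin ⟨i, rfl⟩))
    · rintro _ ⟨i, rfl⟩
      have e : h i * (h β')⁻¹ = (h i * (h β)⁻¹) * (h β' * (h β)⁻¹)⁻¹ := by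
        field_simp [hh β, hh β']
      change h i * (h β')⁻¹ ∈ _
      rw [e]
      exact mul_mem (Algebra.subset_adjoin (Or.inl (Algebra.subset_adjoin ⟨i, rfl⟩)))
        (Algebra.subset_adjoin (Or.inr rfl))

/-- **The sheaf condition for the centre ideals of the standard charts of a vector** (from
`stub_sheafCondition`, i.e. from H₁): an element of `Cen(k[hᵢ/h_β], d)` becomes, after
multiplication by a power of `h_β/h_β'`, an element of `Cen(k[hᵢ/h_β'], d)`. -/
theorem risoCen_sheaf (P : ∀ B : Subalgebra k K, Ideal ↥B → ℕ → Prop) (hloc : RisoLocal P)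
    {N : ℕ} (h : Fin (N + 1) → K) (hh : ∀ i, h i ≠ 0) (d : ℕ) (β β' : Fin (N + 1))
    (c : ↥(Algebra.adjoin k (Set.range fun i => h i * (h β)⁻¹)))
    (hc : c ∈ risoCen P (Algebra.adjoin k (Set.range fun i => h i * (h β)⁻¹)) d) :
    ∃ (n : ℕ) (a : ↥(Algebra.adjoin k (Set.range fun i => h i * (h β')⁻¹))),
      a ∈ risoCen P (Algebra.adjoin k (Set.range fun i => h i * (h β')⁻¹)) d ∧
        (a : K) = (c : K) * (h β * (h β')⁻¹) ^ n := by
  have hfg : ∀ γ : Fin (N + 1), (Algebra.adjoin k (Set.range fun i => h i * (h γ)⁻¹)).FG :=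
    fun γ => Subalgebra.fg_def.mpr ⟨_, Set.finite_range _, rfl⟩
  set s : K := h β' * (h β)⁻¹ with hs
  have hs0 : s ≠ 0 := mul_ne_zero (hh β') (inv_ne_zero (hh β))
  have hsinv : s⁻¹ = h β * (h β')⁻¹ := by rw [hs, mul_inv, inv_inv, mul_comm]
  have hsB : s ∈ Algebra.adjoin k (Set.range fun i => h i * (h β)⁻¹) :=
    Algebra.subset_adjoin ⟨β', rfl⟩
  have hsB' : s⁻¹ ∈ Algebra.adjoin k (Set.range fun i => h i * (h β')⁻¹) := by
    rw [hsinv]; exact Algebra.subset_adjoin ⟨β, rfl⟩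
  have hBB' : Algebra.adjoin k ((Algebra.adjoin k (Set.range fun i => h i * (h β)⁻¹) : Set K) ∪
        {s⁻¹}) =
      Algebra.adjoin k ((Algebra.adjoin k (Set.range fun i => h i * (h β')⁻¹) : Set K) ∪
        {s⁻¹⁻¹}) := by
    rw [hs, adjoin_chart_inv_eq h hh β β', show (h β' * (h β)⁻¹)⁻¹⁻¹ = (h β * (h β')⁻¹)⁻¹ by
      rw [inv_inv, mul_inv, inv_inv, mul_comm], adjoin_chart_inv_eq h hh β' β, Set.union_comm]
  obtain ⟨n, a, ha, hak⟩ := stub_sheafCondition (fun B m => P B m d)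
    (fun B s hs hs0 hBfg m' hm' => hloc B s hs hs0 hBfg m' hm' d) _ _ (hfg β) (hfg β') s hsB hsB'
    hs0 hBB' c hc
  exact ⟨n, a, ha, by rw [hak, hsinv]⟩

/-- One Segre step of the re-presentation: the chart ring of the product vector
`h' = (hᵢ·G_l)_{(i,l)}` (flattened by `segreIndexEquiv`) at the index `(β, μ)` is the chart of
`stub_stepEqChart`. -/
theorem adjoin_segre_chart_eq {N M : ℕ} (h : Fin (N + 1) → K) (G : Fin (M + 1) → K)
    (β : Fin (N + 1)) (μ : Fin (M + 1)) :
    Algebra.adjoin k (Set.range fun t : Fin (N * M + N + M + 1) =>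
        (h ((segreIndexEquiv N M).symm t).1 * G ((segreIndexEquiv N M).symm t).2) *
          (h ((segreIndexEquiv N M).symm (segreIndexEquiv N M (β, μ))).1 *
            G ((segreIndexEquiv N M).symm (segreIndexEquiv N M (β, μ))).2)⁻¹) =
      Algebra.adjoin k (Set.range fun il : Fin (N + 1) × Fin (M + 1) =>
        (h il.1 * G il.2) * (h β * G μ)⁻¹) := by
  congr 1
  simp only [Equiv.symm_apply_apply]
  ext z
  constructor
  · rintro ⟨t, rfl⟩
    exact ⟨(segreIndexEquiv N M).symm t, rfl⟩
  · rintro ⟨il, rfl⟩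
    exact ⟨segreIndexEquiv N M il, by simp only [Equiv.symm_apply_apply]⟩

/-- **The induction on the schedule inside `K`** (the heart of the re-presentation line).
If a vector `h ∈ (K×)ᴺ⁺¹` admits a schedule `sched` along which every valuation ring `O ⊇ k`
containing a chart `k[hᵢ/h_β]` ends — for every admissible choice of denominators — with a
regular local ring at its centre, then there is a vector `u ∈ (K×)ᴺ'⁺¹` (the Segre iterate of
`h` along uniformly generating forms of the successive centres) whose every chart contains a
chart of `h` and such that EVERY chart `k[u_α/u_γ] ⊆ O` of EVERY valuation ring `O ⊇ k` has a
regular local ring at the centre of `O`. Uses H₁ through `risoCen_sheaf`, and the leaves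
`stub_uniformGeneration`, `stub_stepEqChart`. -/
theorem towerInduction (P : ∀ B : Subalgebra k K, Ideal ↥B → ℕ → Prop) (hloc : RisoLocal P)
    (sched : List ℕ) :
    ∀ (N : ℕ) (h : Fin (N + 1) → K), (∀ i, h i ≠ 0) →
      (∀ O : ValuationSubring K, (∀ c : k, algebraMap k K c ∈ O) → ∀ β : Fin (N + 1),
        (∀ i, h i * (h β)⁻¹ ∈ O) → ∀ x : ℕ → K,
          (∀ t, t < sched.length →
            risoValid P O (risoStage P (Algebra.adjoin k (Set.range fun i => h i * (h β)⁻¹))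
              sched x t) (sched.getD t 0) (x t)) →
          IsRegularLocalRing ↥(risoLoc O (risoStage P
            (Algebra.adjoin k (Set.range fun i => h i * (h β)⁻¹)) sched x sched.length))) →
      ∃ (N' : ℕ) (u : Fin (N' + 1) → K), (∀ γ, u γ ≠ 0) ∧
        (∀ γ, ∃ β, Algebra.adjoin k (Set.range fun i => h i * (h β)⁻¹) ≤
          Algebra.adjoin k (Set.range fun α => u α * (u γ)⁻¹)) ∧
        ∀ O : ValuationSubring K, (∀ c : k, algebraMap k K c ∈ O) → ∀ γ : Fin (N' + 1),
          (∀ α, u α * (u γ)⁻¹ ∈ O) →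
            IsRegularLocalRing ↥(risoLoc O (Algebra.adjoin k (Set.range fun α => u α * (u γ)⁻¹))) := by
  induction sched with
  | nil =>
    intro N h hh hyp
    refine ⟨N, h, hh, fun γ => ⟨γ, le_refl _⟩, fun O hkO γ hγ => ?_⟩
    have hreg := hyp O hkO γ hγ (fun _ => 0) (fun t ht => absurd ht (Nat.not_lt_zero t))
    have e0 : risoStage P (Algebra.adjoin k (Set.range fun i => h i * (h γ)⁻¹)) [] (fun _ => 0)
        ([] : List ℕ).length = Algebra.adjoin k (Set.range fun i => h i * (h γ)⁻¹) := by
      simp [risoStage]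
    rw [e0] at hreg
    exact hreg
  | cons d rest ih =>
    intro N h hh hyp
    -- the centre ideals of the charts of `h` at level `d`, uniformly generated by forms `G`
    obtain ⟨E, M, G, hG, hG0, hspan⟩ := stub_uniformGeneration h hh
      (fun β => risoCen P (Algebra.adjoin k (Set.range fun i => h i * (h β)⁻¹)) d)
      (fun β => risoCen_ne_bot P _ (Subalgebra.fg_def.mpr ⟨_, Set.finite_range _, rfl⟩) d)
      (fun β β' c hc => risoCen_sheaf P hloc h hh d β β' c hc)
    -- the Segre vector `h' = (hᵢ G_l)`
    set e := segreIndexEquiv N M with he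
    set h' : Fin (N * M + N + M + 1) → K := fun t => h (e.symm t).1 * G (e.symm t).2 with hh'def
    have hh' : ∀ t, h' t ≠ 0 := fun t => mul_ne_zero (hh _) (hG0 _)
    have h'e : ∀ il, h' (e il) = h il.1 * G il.2 := fun il => by
      simp only [hh'def, Equiv.symm_apply_apply]
    -- `step = chart`
    have hstep : ∀ (β : Fin (N + 1)) (μ : Fin (M + 1)),
        risoStep P (Algebra.adjoin k (Set.range fun i => h i * (h β)⁻¹)) d (G μ * (h β ^ E)⁻¹) =
          Algebra.adjoin k (Set.range fun α => h' α * (h' (e (β, μ)))⁻¹) := by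
      intro β μ
      rw [risoStep, ← hspan β, stub_stepEqChart h hh β G E μ (hG0 μ) (hG β),
        ← adjoin_segre_chart_eq h G β μ]
    -- charts of `h` inside charts of `h'`
    have hchart : ∀ (β : Fin (N + 1)) (μ : Fin (M + 1)),
        Algebra.adjoin k (Set.range fun i => h i * (h β)⁻¹) ≤
          Algebra.adjoin k (Set.range fun α => h' α * (h' (e (β, μ)))⁻¹) := by
      intro β μ
      refine Algebra.adjoin_le ?_
      rintro _ ⟨i, rfl⟩
      refine mem_chart_of_eq h' (e (β, μ)) (e (i, μ)) ?_
      rw [h'e, h'e]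
      field_simp [hG0 μ, hh β]
    -- the hypothesis of the induction for `h'` and `rest`
    have hyp' : ∀ O : ValuationSubring K, (∀ c : k, algebraMap k K c ∈ O) →
        ∀ γ' : Fin (N * M + N + M + 1), (∀ α, h' α * (h' γ')⁻¹ ∈ O) → ∀ x' : ℕ → K,
          (∀ t, t < rest.length →
            risoValid P O (risoStage P (Algebra.adjoin k (Set.range fun α => h' α * (h' γ')⁻¹))
              rest x' t) (rest.getD t 0) (x' t)) →
          IsRegularLocalRing ↥(risoLoc O (risoStage P
            (Algebra.adjoin k (Set.range fun α => h' α * (h' γ')⁻¹)) rest x' rest.length)) := by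
      intro O hkO γ' hγ' x' hval'
      obtain ⟨⟨β, μ⟩, rfl⟩ : ∃ il, e il = γ' := ⟨e.symm γ', e.apply_symm_apply γ'⟩
      -- `k[hᵢ/h_β] ⊆ O`
      have hβ : ∀ i, h i * (h β)⁻¹ ∈ O := fun i =>
        adjoin_le_of_subset hkO (by rintro _ ⟨α, rfl⟩; exact hγ' α) (hchart β μ
          (Algebra.subset_adjoin ⟨i, rfl⟩))
      -- the chart `k[h'/h'_(β,μ)] ⊆ O`
      have hC' : ∀ z ∈ Algebra.adjoin k (Set.range fun α => h' α * (h' (e (β, μ)))⁻¹), z ∈ O :=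
        fun z hz => adjoin_le_of_subset hkO (by rintro _ ⟨α, rfl⟩; exact hγ' α) hz
      -- denominators: the new one first
      set x₀ : K := G μ * (h β ^ E)⁻¹ with hx₀
      let x : ℕ → K := fun t => Nat.casesOn t x₀ x'
      have hx0 : x 0 = x₀ := rfl
      have hxs : (fun i => x (i + 1)) = x' := rfl
      have hval : ∀ t, t < (d :: rest).length →
          risoValid P O (risoStage P (Algebra.adjoin k (Set.range fun i => h i * (h β)⁻¹))
            (d :: rest) x t) ((d :: rest).getD t 0) (x t) := by
        intro t ht
        cases t with
        | zero =>
          simp only [risoStage_zero, List.getD_cons_zero, hx0]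
          refine ⟨mul_ne_zero (hG0 μ) (inv_ne_zero (pow_ne_zero _ (hh β))),
            ⟨⟨x₀, hG β μ⟩, ?_, rfl⟩, fun a' ha' => ?_⟩
          · rw [← hspan β]
            exact Ideal.subset_span ⟨μ, rfl⟩
          · apply hC'
            rw [← hstep β μ]
            exact Algebra.subset_adjoin (Or.inr ⟨a', ha', rfl⟩)
        | succ t =>
          rw [risoStage_cons_succ, hx0, hstep β μ, hxs, List.getD_cons_succ]
          exact hval' t (by simpa using ht)
      have hreg := hyp O hkO β hβ x hval
      rwa [List.length_cons, risoStage_cons_succ, hx0, hstep β μ, hxs] at hreg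
    obtain ⟨N', u, hu, hcharts, hreg⟩ := ih _ h' hh' hyp'
    refine ⟨N', u, hu, fun γ => ?_, hreg⟩
    obtain ⟨γ', hγ'⟩ := hcharts γ
    obtain ⟨⟨β, μ⟩, rfl⟩ : ∃ il, e il = γ' := ⟨e.symm γ', e.apply_symm_apply γ'⟩
    exact ⟨β, (hchart β μ).trans hγ'⟩

end Tower

/-! ## Leaf stubs — projective models with homogeneous coordinates -/

section Models

universe u

variable {k K : Type u} [Field k] [Field K] [Algebra k K]

/-- **The graph-closure model.**  For a projective model `M` of `K/k` with a closed
`k`-immersion `ι_M : M ↪ ℙⁿ_k` and homogeneous coordinates `w` of its generic point, and a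
vector `u ∈ Kᵐ⁺¹ ∖ 0`, the closure model `P := ProjModel.ofClosure` of the `K`-point
`(gen_M, [u])` of `M ×ₖ ℙᵐ_k` dominates `M` (`ofClosure.homOf` of the first projection) and,
through `M ×ₖ ℙᵐ ↪ ℙⁿ ×ₖ ℙᵐ ↪ ℙⁿᵐ⁺ⁿ⁺ᵐ` (Segre), has homogeneous coordinates `w ⊗ u`
(tree `ProjectiveSpace.map_segreEmbedding_lift_pointOfVec`). -/
theorem stub_graphModel (M : ProjModel k K) {n : ℕ}
    (ιM : M.X ⟶ Proj (Segre.grading (Fin (n + 1)) k)) [IsClosedImmersion ιM]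
    (hιM : ιM ≫ Segre.toSpec (Fin (n + 1)) k = M.π) (w : Fin (n + 1) → K) (hw : w ≠ 0)
    (hgenM : M.gen ≫ ιM = (ProjectiveSpace.pointOfVec k w hw).left)
    {m : ℕ} (u : Fin (m + 1) → K) (hu : u ≠ 0) :
    ∃ (P : ProjModel k K) (_ : P.Hom M)
      (ιP : P.X ⟶ Proj (Segre.grading (Fin (n * m + n + m + 1)) k)) (_ : IsClosedImmersion ιP)
      (_ : ιP ≫ Segre.toSpec (Fin (n * m + n + m + 1)) k = P.π),
      P.gen ≫ ιP = (ProjectiveSpace.pointOfVec k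
        (fun t => w ((segreIndexEquiv n m).symm t).1 * u ((segreIndexEquiv n m).symm t).2)
        (ProjectiveSpace.segreVec_ne_zero hw hu)).left := by
  sorry

/-- **Local rings of a projective model with homogeneous coordinates, on a standard chart.**
For `B ↪ ℙⁿ_k` a projective model whose generic point has homogeneous coordinates `w`, and a
point `y` of the chart `ι_B⁻¹ D₊(x_γ)`, every element of the local ring `𝒪_{B,y} ⊆ K` is a
quotient `a · s⁻¹` of elements of the chart ring `k[w_α/w_γ] ⊆ K` with `s` invertible in
`𝒪_{B,y}` (the closed immersion is surjective on stalks, `𝒪_{ℙⁿ,ι y}` is the localisation of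
`Γ(D₊(x_γ)) = k[x_α/x_γ]`, and `ι^*(x_α/x_γ)` has generic value `w_α/w_γ`,
tree `ofSection_homRatio_eq_div`). -/
theorem stub_chartRing (B : ProjModel k K) {n : ℕ}
    (ιB : B.X ⟶ Proj (Segre.grading (Fin (n + 1)) k)) [IsClosedImmersion ιB]
    (hιB : ιB ≫ Segre.toSpec (Fin (n + 1)) k = B.π) (w : Fin (n + 1) → K) (hw : w ≠ 0)
    (hgenB : B.gen ≫ ιB = (ProjectiveSpace.pointOfVec k w hw).left)
    (γ : Fin (n + 1)) (y : B.X) (hy : y ∈ GeneratingSections.preU ιB γ)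
    (z : K) (hz : z ∈ B.stalkSubring y) :
    ∃ a ∈ Algebra.adjoin k (Set.range fun α => w α * (w γ)⁻¹),
      ∃ s ∈ Algebra.adjoin k (Set.range fun α => w α * (w γ)⁻¹),
        s⁻¹ ∈ B.stalkSubring y ∧ z = a * s⁻¹ := by
  sorry

/-- **Which standard chart contains a point**: if all ratios `w_α/w_γ` (with `w_γ ≠ 0`) lie in
the local ring `𝒪_{B,y} ⊆ K`, then `y` lies in the chart `ι_B⁻¹ D₊(x_γ)` (on the chart
`ι_B⁻¹ D₊(x_α) ∋ y` the section `ι^*(x_γ/x_α)` has generic value `w_γ/w_α`, a unit of `𝒪_{B,y}`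
by hypothesis, so `y ∈ B_{ι^*(x_γ/x_α)} = ι⁻¹D₊(x_α) ∩ ι⁻¹D₊(x_γ)`, tree `basicOpen_homRatio`). -/
theorem stub_chartMem (B : ProjModel k K) {n : ℕ}
    (ιB : B.X ⟶ Proj (Segre.grading (Fin (n + 1)) k)) [IsClosedImmersion ιB]
    (hιB : ιB ≫ Segre.toSpec (Fin (n + 1)) k = B.π) (w : Fin (n + 1) → K) (hw : w ≠ 0)
    (hgenB : B.gen ≫ ιB = (ProjectiveSpace.pointOfVec k w hw).left)
    (γ : Fin (n + 1)) (hγ : w γ ≠ 0) (y : B.X)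
    (hmem : ∀ α, w α * (w γ)⁻¹ ∈ B.stalkSubring y) :
    y ∈ GeneratingSections.preU ιB γ := by
  sorry

end Models


/-! ## Glue (models): local rings at centres, read in `K` -/

section ModelsGlue

variable {k K : Type} [Field k] [Field K] [Algebra k K]

/-- Elements of `Algebra.adjoin k S` lie in every subring of `K` containing `k` and `S`. -/
theorem adjoin_le_subring {S : Set K} {T : Subring K}
    (hkT : ∀ c : k, algebraMap k K c ∈ T) (hS : S ⊆ T) {z : K} (hz : z ∈ Algebra.adjoin k S) :
    z ∈ T := by
  induction hz using Algebra.adjoin_induction with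
  | mem x hx => exact hS hx
  | algebraMap c => exact hkT c
  | add x y _ _ hx hy => exact add_mem hx hy
  | mul x y _ _ hx hy => exact mul_mem hx hy

/-- For `s ≠ 0` in a valuation ring `O`: `s⁻¹ ∈ O` iff `O.valuation s = 1`. -/
theorem inv_mem_valuationSubring_iff (O : ValuationSubring K) {s : K} (hs : s ∈ O)
    (hs0 : s ≠ 0) : s⁻¹ ∈ O ↔ O.valuation s = 1 := by
  rw [← O.valuation_le_one_iff, map_inv₀]
  have hv0 : O.valuation s ≠ 0 := by rwa [Ne, map_eq_zero]
  have hle : O.valuation s ≤ 1 := (O.valuation_le_one_iff s).mpr hs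
  rw [inv_le_one₀ (zero_lt_iff.mpr hv0)]
  exact ⟨fun h => le_antisymm hle h, fun h => h.ge⟩

/-- **`loc O B` is `B_{𝔪_O ∩ B}`**: for `B ⊆ O` the route's `loc O B` and the tree's
`locAtCentre B O` (LocalBlowup.lean) have the same elements. -/
theorem coe_risoLoc_eq_locAtCentre (O : ValuationSubring K) (B : Subalgebra k K)
    (hBO : ∀ z ∈ B, z ∈ O) :
    ((risoLoc O B : Subalgebra k K) : Set K) = (locAtCentre B.toSubring O : Set K) := by
  apply le_antisymm
  · intro z hz
    change z ∈ locAtCentre B.toSubring O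
    refine adjoin_le_subring (fun c => le_locAtCentre _ O (B.algebraMap_mem c)) ?_ hz
    rintro _ ⟨a, ha, s, hs, hsO, rfl⟩
    by_cases hs0 : s = 0
    · rw [hs0, inv_zero, mul_zero]; exact Subring.zero_mem _
    · exact mem_locAtCentre_iff.mpr ⟨a, ha, s, hs,
        (inv_mem_valuationSubring_iff O (hBO s hs) hs0).mp hsO, by rw [div_eq_mul_inv]⟩
  · rintro z ⟨a, ha, s, hs, hv, rfl⟩
    have hs0 : (s : K) ≠ 0 := ne_zero_of_valuation_eq_one hv
    change a / s ∈ risoLoc O B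
    rw [div_eq_mul_inv]
    exact Algebra.subset_adjoin ⟨a, ha, s, hs,
      (inv_mem_valuationSubring_iff O (hBO s hs) hs0).mpr hv, rfl⟩

/-- Regularity of `loc O B` is regularity of `locAtCentre B O`. -/
theorem isRegularLocalRing_locAtCentre_of_risoLoc (O : ValuationSubring K) (B : Subalgebra k K)
    (hBO : ∀ z ∈ B, z ∈ O) (hreg : IsRegularLocalRing ↥(risoLoc O B)) :
    IsRegularLocalRing ↥(locAtCentre B.toSubring O) := by
  have hset := coe_risoLoc_eq_locAtCentre O B hBO
  let e : ↥(risoLoc O B) ≃+* ↥(locAtCentre B.toSubring O) :=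
    { toFun := fun z => ⟨z.1, by rw [← SetLike.mem_coe, ← hset]; exact z.2⟩
      invFun := fun z => ⟨z.1, by rw [← SetLike.mem_coe, hset]; exact z.2⟩
      left_inv := fun z => rfl
      right_inv := fun z => rfl
      map_mul' := fun _ _ => rfl
      map_add' := fun _ _ => rfl }
  exact IsRegularLocalRing.of_ringEquiv e

variable (B : ProjModel k K) {n : ℕ} (ιB : B.X ⟶ Proj (Segre.grading (Fin (n + 1)) k))
  [IsClosedImmersion ιB] (hιB : ιB ≫ Segre.toSpec (Fin (n + 1)) k = B.π)
  (w : Fin (n + 1) → K) (hw : w ≠ 0)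
  (hgenB : B.gen ≫ ιB = (ProjectiveSpace.pointOfVec k w hw).left)

include hιB hgenB in
/-- **The local ring at the centre of a valuation, in coordinates.** If all ratios `w_α/w_γ` lie
in `𝒪_{B,y}`, `y` the centre of `v`, then `𝒪_{B,y} ⊆ K` IS the localisation at the centre of
`v` of the chart ring `k[w_α/w_γ]` (leaves `stub_chartMem`, `stub_chartRing`, and domination of
`𝒪_{B,y}` by `𝒪_v`). -/
theorem stalkSubring_centre_eq_locAtCentre (v : ZariskiRiemannSpace k K) (γ : Fin (n + 1))
    (hγ : w γ ≠ 0) (hmem : ∀ α, w α * (w γ)⁻¹ ∈ B.stalkSubring (B.centre v)) :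
    B.stalkSubring (B.centre v) =
      locAtCentre (Algebra.adjoin k (Set.range fun α => w α * (w γ)⁻¹)).toSubring
        v.asValuationSubring := by
  set y := B.centre v with hy
  have hdom : SubringDominates (B.stalkSubring y) v.asValuationSubring.toSubring :=
    B.isCentreOf_centre v
  have hyU : y ∈ GeneratingSections.preU ιB γ := stub_chartMem B ιB hιB w hw hgenB γ hγ y hmem
  have hC : ∀ z ∈ Algebra.adjoin k (Set.range fun α => w α * (w γ)⁻¹), z ∈ B.stalkSubring y :=
    fun z hz => adjoin_le_subring (fun c => B.algebraMap_mem_stalkSubring y c)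
      (by rintro _ ⟨α, rfl⟩; exact hmem α) hz
  apply le_antisymm
  · intro z hz
    obtain ⟨a, ha, s, hs, hsinv, rfl⟩ := stub_chartRing B ιB hιB w hw hgenB γ y hyU z hz
    by_cases hs0 : s = 0
    · rw [hs0, inv_zero, mul_zero]; exact Subring.zero_mem _
    · refine mem_locAtCentre_iff.mpr ⟨a, ha, s, hs, ?_, by rw [div_eq_mul_inv]⟩
      exact (inv_mem_valuationSubring_iff _ (hdom.1 (hC s hs)) hs0).mp (hdom.1 hsinv)
  · rintro z ⟨a, ha, s, hs, hv1, rfl⟩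
    have hs0 : (s : K) ≠ 0 := ne_zero_of_valuation_eq_one hv1
    have hsinvO : s⁻¹ ∈ v.asValuationSubring :=
      (inv_mem_valuationSubring_iff _ (hdom.1 (hC s hs)) hs0).mpr hv1
    rw [div_eq_mul_inv]
    exact mul_mem (hC a ha) (hdom.2 s (hC s hs) hsinvO)

include hιB hgenB in
/-- **Regular centre from a regular chart local ring** (exit of the line towards
`ProjModel.isRegular_of_forall_regCentre`): with `𝒪_{B,centre v} = (k[w_α/w_γ])_{𝔪_v ∩ ·}` as
above, regularity of the route's `loc 𝒪_v k[w_α/w_γ]` gives `B.RegCentre v`. -/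
theorem regCentre_of_isRegularLocalRing_risoLoc (v : ZariskiRiemannSpace k K) (γ : Fin (n + 1))
    (hγ : w γ ≠ 0) (hmem : ∀ α, w α * (w γ)⁻¹ ∈ B.stalkSubring (B.centre v))
    (hreg : IsRegularLocalRing
      ↥(risoLoc v.asValuationSubring (Algebra.adjoin k (Set.range fun α => w α * (w γ)⁻¹)))) :
    B.RegCentre v := by
  have hCO : ∀ z ∈ Algebra.adjoin k (Set.range fun α => w α * (w γ)⁻¹),
      z ∈ v.asValuationSubring :=
    fun z hz => (B.isCentreOf_centre v).1 (adjoin_le_subring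
      (fun c => B.algebraMap_mem_stalkSubring _ c) (by rintro _ ⟨α, rfl⟩; exact hmem α) hz)
  have h1 := isRegularLocalRing_locAtCentre_of_risoLoc _ _ hCO hreg
  have heq := stalkSubring_centre_eq_locAtCentre B ιB hιB w hw hgenB v γ hγ hmem
  let e : B.X.presheaf.stalk (B.centre v) ≃+*
      ↥(locAtCentre (Algebra.adjoin k (Set.range fun α => w α * (w γ)⁻¹)).toSubring
        v.asValuationSubring) :=
    (B.stalkEquiv (B.centre v)).trans (RingEquiv.subringCongr heq)
  exact IsRegularLocalRing.of_ringEquiv e.symm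

end ModelsGlue


/-! ## Assembly: the resolving model of an integral closed subscheme of `ℙⁿ_k` -/

section Assembly

variable {k : Type} [Field k]

/-- **The projective integral case.**  For an integral closed subscheme `X ⊆ ℙⁿ_k`: make `X`
a projective model `M₀` of its function field `K` (an affine chart `Spec A`,
`ProjModel.ofChart`, as in the tree's `hasResolution_of_twoModelPatching_of_dim_three`), take
homogeneous coordinates `w` of its generic point, apply H₂ to the vector `h` of NONZERO
coordinates (`K = k(hᵢ/hⱼ)` by the chart computation at the generic point), run the tower inside
`K` (`towerInduction`) to get `u`, form the graph-closure model `P → M₀` of `(gen, [u])`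
(`stub_graphModel`) with Segre coordinates `w ⊗ u`, and read the local ring at the centre of
every valuation `v` as the localisation of the `𝒪_v`-minimal chart `k[u_α/u_γ]` (the chart
`(β, γ)` of `w ⊗ u`, `β` with `k[hᵢ/h_β] ⊆ k[u_α/u_γ]`, contains the centre: unit trick +
`stub_chartMem`), which is regular by the conclusion of the tower; conclude by
`isRegular_of_forall_regCentre` and `Hom.hasResolution`. -/
theorem hasResolution_of_isClosedImmersion_projectiveSpace
    (P : ∀ (K : Type) [Field K] [Algebra k K] (B : Subalgebra k K), Ideal ↥B → ℕ → Prop)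
    (hloc : ∀ (K : Type) [Field K] [Algebra k K], RisoLocal (P K))
    (hres : ∀ (K : Type) [Field K] [Algebra k K] (N : ℕ) (h : Fin (N + 1) → K),
      (∀ i, h i ≠ 0) →
      IntermediateField.adjoin k
          (Set.range fun ij : Fin (N + 1) × Fin (N + 1) => h ij.1 * (h ij.2)⁻¹) = ⊤ →
        RisoSchedule (P K) N h)
    {n : ℕ} (X : Scheme.{0}) [IsIntegral X] (c : X ⟶ (Literature.AlgebraicGeometry.Motives.projectiveSpace n k).left)
    [IsClosedImmersion c] : Scheme.HasResolution X := by
  classical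
  haveI : IsProper (Literature.AlgebraicGeometry.Motives.projectiveSpace n k).hom := Literature.AlgebraicGeometry.Motives.isProper_projectiveSpace n k
  let πX : X ⟶ Spec (.of k) := c ≫ (Literature.AlgebraicGeometry.Motives.projectiveSpace n k).hom
  have hproj : Literature.AlgebraicGeometry.Motives.IsProjectiveOver (Over.mk πX) := ⟨n, Over.homMk c rfl, ‹_›⟩
  haveI : LocallyOfFiniteType πX := inferInstance
  /- an affine chart `U = Spec A` of `X` and `X` as a projective model of `K = Frac A`
    (verbatim from `hasResolution_of_twoModelPatching_of_dim_three`) -/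
  obtain ⟨_, ⟨U', hU', rfl⟩, hηU, -⟩ := X.isBasis_affineOpens.exists_subset_of_mem_open
    (Set.mem_univ (genericPoint X)) isOpen_univ
  let U : X.Opens := U'
  have hU : IsAffineOpen U := hU'
  haveI : IsAffine U := hU
  haveI : Nonempty U := ⟨⟨_, hηU⟩⟩
  let A : Type := Γ(U, ⊤)
  let g : (U : Scheme.{0}) ⟶ Spec (.of k) := U.ι ≫ πX
  let ψ : k →+* A := g.appTop.hom.comp (Scheme.ΓSpecIso (.of k)).inv.hom
  have hψ : ψ.FiniteType := by
    have h1 : g.appTop.hom.FiniteType :=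
      (HasRingHomProperty.iff_of_isAffine (P := @LocallyOfFiniteType)).mp inferInstance
    exact h1.comp (RingHom.FiniteType.of_surjective _
      (Scheme.ΓSpecIso (.of k)).symm.commRingCatIsoToRingEquiv.surjective)
  letI : Algebra k A := ψ.toAlgebra
  haveI hft : Algebra.FiniteType k A := hψ
  let K : Type := FractionRing A
  let j : Spec (.of A) ⟶ X := U.toScheme.isoSpec.inv ≫ U.ι
  have hj : j ≫ πX = Spec.map (CommRingCat.ofHom (algebraMap k A)) := by
    change (U.toScheme.isoSpec.inv ≫ U.ι) ≫ πX = Spec.map (CommRingCat.ofHom ψ)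
    rw [Category.assoc, isoSpec_inv_comp]
    rfl
  let M₀ : ProjModel k K := ProjModel.ofChart (K := K) X πX hproj A j hj
  /- homogeneous coordinates of the generic point and the vector `h` of the nonzero ones -/
  obtain ⟨n', ιM, hιMci, hιM, w, hw, hgenM⟩ := M₀.exists_coords
  haveI := hιMci
  have hSne : Nonempty {i : Fin (n' + 1) // w i ≠ 0} := by
    obtain ⟨i, hi⟩ := Function.ne_iff.mp hw
    exact ⟨⟨i, hi⟩⟩
  obtain ⟨N, hN⟩ : ∃ N : ℕ, Fintype.card {i : Fin (n' + 1) // w i ≠ 0} = N + 1 :=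
    Nat.exists_eq_succ_of_ne_zero Fintype.card_ne_zero
  let eS : Fin (N + 1) ≃ {i : Fin (n' + 1) // w i ≠ 0} := (Fintype.equivFinOfCardEq hN).symm
  let h : Fin (N + 1) → K := fun a => w (eS a).1
  have hh : ∀ a, h a ≠ 0 := fun a => (eS a).2
  have hratio : ∀ (i : Fin (n' + 1)) (β : Fin (N + 1)),
      w i * (w (eS β).1)⁻¹ ∈ Algebra.adjoin k (Set.range fun a => h a * (h β)⁻¹) := by
    intro i β
    by_cases hwi : w i = 0
    · rw [hwi, zero_mul]; exact Subalgebra.zero_mem _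
    · refine Algebra.subset_adjoin ⟨eS.symm ⟨i, hwi⟩, ?_⟩
      simp only [h, Equiv.apply_symm_apply]
  /- `K = k(hᵢ/hⱼ)`: the local ring at the generic point is `K` and lies on a chart -/
  have hgenK : IntermediateField.adjoin k
      (Set.range fun ij : Fin (N + 1) × Fin (N + 1) => h ij.1 * (h ij.2)⁻¹) = ⊤ := by
    set F := IntermediateField.adjoin k
      (Set.range fun ij : Fin (N + 1) × Fin (N + 1) => h ij.1 * (h ij.2)⁻¹) with hF
    have hξ : M₀.stalkSubring (genericPoint M₀.X) = ⊤ := M₀.stalkSubring_genericPoint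
    set i₀ : Fin (n' + 1) := (eS 0).1 with hi₀def
    have hi₀ : w i₀ ≠ 0 := (eS 0).2
    have hCF : ∀ z ∈ Algebra.adjoin k (Set.range fun α => w α * (w i₀)⁻¹), z ∈ F := by
      intro z hz
      refine adjoin_le_subring (T := F.toSubalgebra.toSubring) (fun c => F.algebraMap_mem c) ?_ hz
      rintro _ ⟨α, rfl⟩
      have hmem := hratio α 0
      refine adjoin_le_subring (T := F.toSubalgebra.toSubring) (fun c => F.algebraMap_mem c)
        ?_ hmem
      rintro _ ⟨a, rfl⟩
      exact IntermediateField.subset_adjoin k _ ⟨(a, 0), rfl⟩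
    have hξU : genericPoint M₀.X ∈ GeneratingSections.preU ιM i₀ :=
      stub_chartMem M₀ ιM hιM w hw hgenM i₀ hi₀ (genericPoint M₀.X)
        (fun α => by rw [hξ]; exact Subring.mem_top _)
    rw [eq_top_iff]
    intro z _
    obtain ⟨a, ha, s, hs, -, rfl⟩ := stub_chartRing M₀ ιM hιM w hw hgenM i₀ (genericPoint M₀.X)
      hξU z (by rw [hξ]; exact Subring.mem_top _)
    exact mul_mem (hCF a ha) (inv_mem (hCF s hs))
  /- H₂ for `h`, and the tower inside `K` -/
  obtain ⟨sched, hsched⟩ := hres K N h hh hgenK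
  obtain ⟨N', u, hu, hcharts, hreg⟩ := towerInduction (P K) (hloc K) sched N h hh hsched
  have hu' : u ≠ 0 := fun h0 => hu 0 (congr_fun h0 0)
  /- the graph-closure model `P → M₀` with Segre coordinates `w ⊗ u` -/
  obtain ⟨Pm, φ, ιP, hιPci, hιP, hgenP⟩ := stub_graphModel M₀ ιM hιM w hw hgenM u hu'
  haveI := hιPci
  set e := segreIndexEquiv n' N' with hedef
  set wu : Fin (n' * N' + n' + N' + 1) → K := fun t => w (e.symm t).1 * u (e.symm t).2
    with hwudef
  have hwu : wu ≠ 0 := ProjectiveSpace.segreVec_ne_zero hw hu'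
  have hwu_e : ∀ i a, wu (e (i, a)) = w i * u a := fun i a => by
    simp only [hwudef, Equiv.symm_apply_apply]
  /- every centre of `P` is regular -/
  have hPreg : ∀ v : ZariskiRiemannSpace k K, Pm.RegCentre v := by
    intro v
    set O := v.asValuationSubring with hO
    have hkO : ∀ c' : k, algebraMap k K c' ∈ O := v.algebraMap_mem
    -- the `O`-minimal chart `γ` of `u`, and `β` with `k[hᵢ/h_β] ⊆ k[u_α/u_γ]`
    obtain ⟨γ, -, hγO⟩ := definedOn_valuationSubring (w := u) ⟨0, hu 0⟩ O
    have hγO' : ∀ α, u α * (u γ)⁻¹ ∈ O := fun α => by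
      simpa only [div_eq_mul_inv, ValuationSubring.mem_toSubring] using hγO α
    have hCγO : ∀ z ∈ Algebra.adjoin k (Set.range fun α => u α * (u γ)⁻¹), z ∈ O :=
      fun z hz => adjoin_le_of_subset hkO (by rintro _ ⟨α, rfl⟩; exact hγO' α) hz
    obtain ⟨β, hβ⟩ := hcharts γ
    -- the centre and a chart `t₀` through it
    set y := Pm.centre v with hy
    have hdom : SubringDominates (Pm.stalkSubring y) O.toSubring := Pm.isCentreOf_centre v
    obtain ⟨t₀, ht₀, hdef⟩ :=
      ProjModel.HasCentre.definedOn Pm ιP hιP wu hwu hgenP ⟨y, Pm.isCentreOf_self y⟩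
    -- the chart `t₁ = (β, γ)` also contains the centre (unit trick)
    set t₁ := e ((eS β).1, γ) with ht₁def
    have ht₁ : wu t₁ ≠ 0 := by rw [ht₁def, hwu_e]; exact mul_ne_zero (hh β) (hu γ)
    obtain ⟨⟨i, α⟩, hiα⟩ : ∃ p, e p = t₀ := ⟨e.symm t₀, e.apply_symm_apply t₀⟩
    have hwi : w i ≠ 0 := by
      have ht₀' := ht₀
      rw [← hiα, hwu_e] at ht₀'
      exact left_ne_zero_of_mul ht₀'
    have hT : wu t₀ * (wu t₁)⁻¹ ∈ O := by
      have e1 : wu t₀ * (wu t₁)⁻¹ = (w i * (w (eS β).1)⁻¹) * (u α * (u γ)⁻¹) := by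
        rw [← hiα, ht₁def, hwu_e, hwu_e, mul_inv]
        ring
      rw [e1]
      exact mul_mem (hCγO _ (hβ (hratio i β))) (hγO' α)
    have hTinv : (wu t₀ * (wu t₁)⁻¹)⁻¹ ∈ Pm.stalkSubring y := by
      rw [mul_inv, inv_inv, mul_comm, ← div_eq_mul_inv]
      exact hdef t₁
    have hTy : wu t₀ * (wu t₁)⁻¹ ∈ Pm.stalkSubring y := by
      have := hdom.2 _ hTinv (by rw [inv_inv]; exact hT)
      rwa [inv_inv] at this
    have hmem : ∀ t, wu t * (wu t₁)⁻¹ ∈ Pm.stalkSubring y := fun t => by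
      have e1 : (wu t / wu t₀) * (wu t₀ * (wu t₁)⁻¹) = wu t * (wu t₁)⁻¹ := by
        rw [← mul_assoc, div_mul_cancel₀ _ ht₀]
      rw [← e1]
      exact mul_mem (hdef t) hTy
    -- the chart ring at `t₁` IS `k[u_α/u_γ]`
    have hCeq : Algebra.adjoin k (Set.range fun t => wu t * (wu t₁)⁻¹) =
        Algebra.adjoin k (Set.range fun α => u α * (u γ)⁻¹) := by
      apply le_antisymm
      · refine Algebra.adjoin_le ?_
        rintro _ ⟨t, rfl⟩
        obtain ⟨⟨i', α'⟩, rfl⟩ : ∃ p, e p = t := ⟨e.symm t, e.apply_symm_apply t⟩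
        have e1 : wu (e (i', α')) * (wu t₁)⁻¹ =
            (w i' * (w (eS β).1)⁻¹) * (u α' * (u γ)⁻¹) := by
          rw [ht₁def, hwu_e, hwu_e, mul_inv]
          ring
        change wu (e (i', α')) * (wu t₁)⁻¹ ∈ Algebra.adjoin k (Set.range fun α => u α * (u γ)⁻¹)
        rw [e1]
        exact mul_mem (hβ (hratio i' β)) (Algebra.subset_adjoin ⟨α', rfl⟩)
      · refine Algebra.adjoin_le ?_
        rintro _ ⟨α', rfl⟩
        refine mem_chart_of_eq wu t₁ (e ((eS β).1, α')) ?_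
        rw [ht₁def, hwu_e, hwu_e, mul_inv, mul_mul_mul_comm, mul_inv_cancel₀ (hh β), one_mul]
    -- regularity at the centre of `v`
    refine regCentre_of_isRegularLocalRing_risoLoc Pm ιP hιP wu hwu hgenP v t₁ ht₁ hmem ?_
    rw [hCeq]
    exact hreg O hkO γ hγO'
  exact φ.hasResolution (ProjModel.isRegular_of_forall_regCentre hPreg)

/-- **Generic globalisation** (the former lead-held stub `stub_core`, now proved): Chow's lemma
(`ChowLemmaIntegral_holds`) and the projective closure (`exists_projectiveClosure`) reduce to
the projective integral case, and resolutions descend along proper birational morphisms and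
restrict to opens. -/
theorem risoGlobalisation_core
    (P : ∀ (K : Type) [Field K] [Algebra k K] (B : Subalgebra k K), Ideal ↥B → ℕ → Prop)
    (hloc : ∀ (K : Type) [Field K] [Algebra k K], RisoLocal (P K))
    (hres : ∀ (K : Type) [Field K] [Algebra k K] (N : ℕ) (h : Fin (N + 1) → K),
      (∀ i, h i ≠ 0) →
      IntermediateField.adjoin k
          (Set.range fun ij : Fin (N + 1) × Fin (N + 1) => h ij.1 * (h ij.2)⁻¹) = ⊤ →
        RisoSchedule (P K) N h)
    (X : Scheme.{0}) (f : X ⟶ Spec (.of k)) [IsSeparated f] [LocallyOfFiniteType f]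
    [QuasiCompact f] [IsIntegral X] : Scheme.HasResolution X := by
  obtain ⟨n, X', π, ι, hint', hι, hπ, -, -, U, hU, hU', hiso⟩ :=
    ChowLemmaIntegral_holds k X f inferInstance inferInstance inferInstance inferInstance
  haveI := hπ
  haveI := hι
  haveI := hint'
  have hbir : IsBirational π := ⟨U, hU, hU', hiso⟩
  obtain ⟨Xbar, j, c, hXbar, hj, hc, -, -⟩ := exists_projectiveClosure ι
  haveI := hj
  haveI := hc
  haveI := hXbar
  have hresbar : Scheme.HasResolution Xbar :=
    hasResolution_of_isClosedImmersion_projectiveSpace P hloc hres Xbar c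
  exact Scheme.HasResolution.of_isBirational π hbir (hresbar.of_isOpenImmersion j)

end Assembly

/-! ## The crux by name -/

/-- **`RisoGlobalisation`** (crux stmt-ResolutionOfSingularities-18547) from the generic core:
instantiate the cut predicate at `P B m d := ¬ Rtd B m (d + 1)`, the route's
riso-triviality-dimension cut (written out as a closed term; the `let`-bound `Arc`, `Rtd`,
`Cen`, `step`, `Valid`, `stage`, `loc` of the Theses file unfold to it definitionally). -/
theorem RisoGlobalisation_of :
    Summit.ResolutionOfSingularities.ResolutionOfSingularities.Theses.RisoStrata.RisoGlobalisation := by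
  intro p hp hloc hres k _ _ _ X f hsep hft hqc hint
  haveI := hsep; haveI := hft; haveI := hqc; haveI := hint
  exact risoGlobalisation_core
    (P := fun (K : Type) (_ : Field K) (_ : Algebra k K) (B : Subalgebra k K) (m : Ideal ↥B)
      (d : ℕ) => ¬ ((fun (r : ℕ) => (∃ (n : ℕ) (g : Fin n → ↥B), (∀ i, g i ∈ m) ∧
        Algebra.adjoin k (Set.range fun i => (g i : K)) = B ∧
        ∃ W : Submodule k (Fin n → k), r ≤ Module.finrank k ↥W ∧
        ∃ φ : {α : ↥B →ₐ[k] HahnSeries ℚ k // ∀ b ∈ m, 0 < (α b).orderTop} →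
          (Fin n → HahnSeries ℚ k),
        (∀ a b : {α : ↥B →ₐ[k] HahnSeries ℚ k // ∀ b ∈ m, 0 < (α b).orderTop}, a ≠ b →
          ∃ j, ∀ i, (a.1 (g j) - b.1 (g j)).orderTop <
            ((φ a i - φ b i) - (a.1 (g i) - b.1 (g i))).orderTop) ∧
        (∀ a i, 0 < (φ a i).orderTop) ∧
        (∀ a, ∀ w : Fin n → HahnSeries ℚ k, (∀ i, 0 < (w i).orderTop) →
          w ∈ Submodule.span (HahnSeries ℚ k)
            ((fun u : Fin n → k => fun i => HahnSeries.C (u i)) '' (W : Set (Fin n → k))) →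
          ∃ b, φ b = φ a + w))) (d + 1)))
    (fun K _ _ => by
      intro B s hs hs0 hfg m' hm' d
      exact not_congr (hloc k K B s hs hs0 hfg m' hm' (d + 1)))
    (fun K _ _ N h hh hgen => hres k K N h hh hgen) X f

end Summit.ResolutionOfSingularities.ResolutionOfSingularities.Theorems
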